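import Literature.Computability.Complexity.CodeFPArith
import Mathlib.Data.Nat.Squarefree
import HarnessLib

/-!
# The cube-part decomposition `m = f³ab²`, `ab` squarefree, from the factor list, in polynomial time

Topic `Literature/Computability/Complexity` (typed `CodeFP` algebra, next to `NatCbrtFP.lean`). Every
positive integer is uniquely `m = f³ a b²` with `ab` squarefree (`f = ∏ p^{⌊v_p(m)/3⌋}`, `a`/`b` the
product of the primes with `v_p(m) ≡ 1`/`≡ 2 (mod 3)`): the shape in which a pure cubic field
`ℚ(∛m) = ℚ(∛(ab²))` and Dedekind's integral basis are read off (Cohen 1993, §6.4.5; Hallgren 2005,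
§1: the quantum algorithms for number fields of constant degree start from the factorisation of the
input). Classically no polynomial-time route to `(f, a, b)` from `m` is known (it yields the squarefree
part); FROM THE PRIME FACTORISATION it is a fold:

* `CubeSplit.fst_mul_pow_foldl`, `…foldl_pos`, `…foldl_le`, `…factorization_foldl_le`,
  `…factorization_foldl_add` — the invariants of the fold with step
  `q ▸ (n, g) ↦ if 0 < n ∧ qᵉ ∣ n then (n / qᵉ, g·q) else (n, g)` over a list of primes: `n·gᵉ` is
  constant; `v_p` of the first component ends below `e` as soon as `p` occurs at least `⌊v_p(n)/e⌋`
  times; `v_p(n) + e·v_p(g)` is constant;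
* **`CubeSplit.exists_split`** — a `CodeFP (pairE (rawE natE) natE) (pairE natE (pairE natE natE))` program
  `split` (two such folds over the given list, `e = 3` then `e = 2`, by `CodeFP.foldl`) with
  `split (primeFactorsList m, m) = (f, a, b)`, `m = f³·(a·b²)`, `Squarefree (a·b)` for every `m ≥ 1`.

Stated abstractly over any `step` function with the displayed values (no definition is introduced);
theorem-only file.

## References

* H. Cohen, *A Course in Computational Algebraic Number Theory*, GTM 138, Springer 1993, §6.4.5
  (pure cubic fields `ℚ(∛(ab²))`) [Cohen1993].
* S. Hallgren, *Fast quantum algorithms for computing the unit group and class group of a number field*,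
  STOC 2005, §1 [Hallgren2005].
* S. Arora, B. Barak, *Computational Complexity: A Modern Approach*, CUP 2009, §1.3 (polynomial time is
  closed under bounded loops) [AroraBarak2009].
-/

namespace Literature.Computability.Complexity.CodeFP

namespace CubeSplit

open _root_.Computability Polynomial

variable {e : ℕ} {step : ℕ → ℕ × ℕ → ℕ × ℕ}

/-! ### Invariants of the dividing fold -/

/-- **`n · gᵉ` is invariant** along the fold. [folklore] -/
theorem fst_mul_pow_foldl
    (hstep : ∀ q n g, step q (n, g) = if 0 < n ∧ n % q ^ e = 0 then (n / q ^ e, g * q) else (n, g)) :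
    ∀ (l : List ℕ) (n g : ℕ), (l.foldl (fun st q => step q st) (n, g)).1 *
      (l.foldl (fun st q => step q st) (n, g)).2 ^ e = n * g ^ e
  | [], n, g => rfl
  | q :: l, n, g => by
    rw [List.foldl_cons, hstep]
    split_ifs with h
    · rw [fst_mul_pow_foldl hstep l, mul_pow, mul_comm (g ^ e), ← mul_assoc,
        Nat.div_mul_cancel (Nat.dvd_of_mod_eq_zero h.2)]
    · exact fst_mul_pow_foldl hstep l n g

/-- The first component stays positive and the second component never decreases (`e ≥ 1`).
[folklore] -/
theorem foldl_pos (he : 0 < e)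
    (hstep : ∀ q n g, step q (n, g) = if 0 < n ∧ n % q ^ e = 0 then (n / q ^ e, g * q) else (n, g)) :
    ∀ (l : List ℕ) (n g : ℕ), 0 < n →
      0 < (l.foldl (fun st q => step q st) (n, g)).1 ∧ g ≤ (l.foldl (fun st q => step q st) (n, g)).2
  | [], _, _, hn => ⟨hn, le_rfl⟩
  | q :: l, n, g, hn => by
    rw [List.foldl_cons, hstep]
    split_ifs with h
    · have hq : q ≠ 0 := by
        rintro rfl
        rw [zero_pow he.ne', Nat.mod_zero] at h
        exact absurd h.2 hn.ne'
      have hqe : 0 < q ^ e := pow_pos (Nat.pos_of_ne_zero hq) e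
      have h' := foldl_pos he hstep l (n / q ^ e) (g * q)
        (Nat.div_pos (Nat.le_of_dvd hn (Nat.dvd_of_mod_eq_zero h.2)) hqe)
      exact ⟨h'.1, (Nat.le_mul_of_pos_right g (Nat.pos_of_ne_zero hq)).trans h'.2⟩
    · exact foldl_pos he hstep l n g hn

/-- With first component `0` nothing happens. [folklore] -/
theorem foldl_zero
    (hstep : ∀ q n g, step q (n, g) = if 0 < n ∧ n % q ^ e = 0 then (n / q ^ e, g * q) else (n, g)) :
    ∀ (l : List ℕ) (g : ℕ), l.foldl (fun st q => step q st) (0, g) = (0, g)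
  | [], _ => rfl
  | q :: l, g => by
    rw [List.foldl_cons, hstep, if_neg (fun h => lt_irrefl 0 h.1)]
    exact foldl_zero hstep l g

/-- **Size of the state**: the first component is at most the initial one, and, started at `g = 1`,
the second is at most `max n 1` (`e ≥ 1`). [folklore] -/
theorem foldl_le (he : 0 < e)
    (hstep : ∀ q n g, step q (n, g) = if 0 < n ∧ n % q ^ e = 0 then (n / q ^ e, g * q) else (n, g))
    (l : List ℕ) (n : ℕ) :
    (l.foldl (fun st q => step q st) (n, 1)).1 ≤ n ∧
      (l.foldl (fun st q => step q st) (n, 1)).2 ≤ max n 1 := by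
  rcases Nat.eq_zero_or_pos n with rfl | hn
  · rw [foldl_zero hstep]; exact ⟨le_rfl, le_max_right _ _⟩
  · have hinv := fst_mul_pow_foldl hstep l n 1
    rw [one_pow, mul_one] at hinv
    obtain ⟨h1, h2⟩ := foldl_pos he hstep l n 1 hn
    set a := (l.foldl (fun st q => step q st) (n, 1)).1
    set b := (l.foldl (fun st q => step q st) (n, 1)).2
    refine ⟨?_, (le_max_left n 1).trans' ?_⟩
    · calc a = a * 1 := (mul_one a).symm
        _ ≤ a * b ^ e := Nat.mul_le_mul_left a (Nat.succ_le_of_lt (pow_pos h2 e))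
        _ = n := hinv
    · calc b ≤ b ^ e := Nat.le_self_pow he.ne' b
        _ ≤ a * b ^ e := Nat.le_mul_of_pos_left _ h1
        _ = n := hinv

/-! ### Valuations along the fold (lists of primes) -/

/-- **Enough occurrences of `p` bring `v_p` below `e`**: over a list of primes, started at `n ≥ 1` with
`v_p(n) ≤ e·#{occurrences of p} + (e − 1)`, the fold ends with `v_p < e` in the first component (each
occurrence of `p` divides `pᵉ` out while possible; the other primes do not touch `v_p`). [folklore] -/
theorem factorization_foldl_le (he : 0 < e)
    (hstep : ∀ q n g, step q (n, g) = if 0 < n ∧ n % q ^ e = 0 then (n / q ^ e, g * q) else (n, g))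
    {p : ℕ} (hp : p.Prime) :
    ∀ (l : List ℕ) (n g : ℕ), (∀ q ∈ l, q.Prime) → 0 < n →
      n.factorization p ≤ e * l.count p + (e - 1) →
      (l.foldl (fun st q => step q st) (n, g)).1.factorization p ≤ e - 1
  | [], n, g, _, _, hv => by simpa using hv
  | q :: l, n, g, hl, hn, hv => by
    have hq : q.Prime := hl q (by simp)
    have hl' : ∀ q' ∈ l, q'.Prime := fun q' hq' => hl q' (by simp [hq'])
    rw [List.foldl_cons, hstep]
    have hcount : (q :: l).count p = l.count p + (if q = p then 1 else 0) := by
      rw [List.count_cons]; simp [beq_iff_eq]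
    rw [hcount] at hv
    split_ifs with h
    · -- `qᵉ` is divided out
      have hdvd : q ^ e ∣ n := Nat.dvd_of_mod_eq_zero h.2
      refine factorization_foldl_le he hstep hp l _ _ hl'
        (Nat.div_pos (Nat.le_of_dvd hn hdvd) (pow_pos hq.pos e)) ?_
      rw [Nat.factorization_div hdvd, Finsupp.coe_tsub, Pi.sub_apply, Nat.factorization_pow,
        Finsupp.smul_apply, hq.factorization, Finsupp.single_apply, smul_eq_mul]
      by_cases hqp : q = p
      · rw [if_pos hqp, mul_add, mul_one] at hv; rw [if_pos hqp, mul_one]; omega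
      · rw [if_neg hqp, add_zero] at hv; rw [if_neg hqp, mul_zero, Nat.sub_zero]; omega
    · -- no division: if `q = p` then `pᵉ ∤ n`, so `v_p(n) < e` already
      refine factorization_foldl_le he hstep hp l n g hl' hn ?_
      by_cases hqp : q = p
      · subst hqp
        have hlt : n.factorization q < e := by
          by_contra hle
          exact h ⟨hn, Nat.mod_eq_zero_of_dvd ((hq.pow_dvd_iff_le_factorization hn.ne').2 (not_lt.1 hle))⟩
        omega
      · rw [if_neg hqp] at hv; omega

/-- **`v_p(n) + e·v_p(g)` is invariant** along the fold over a list of primes (`n, g ≥ 1`). [folklore] -/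
theorem factorization_foldl_add
    (hstep : ∀ q n g, step q (n, g) = if 0 < n ∧ n % q ^ e = 0 then (n / q ^ e, g * q) else (n, g))
    (p : ℕ) :
    ∀ (l : List ℕ) (n g : ℕ), (∀ q ∈ l, q.Prime) → 0 < n → 0 < g →
      (l.foldl (fun st q => step q st) (n, g)).1.factorization p +
          e * (l.foldl (fun st q => step q st) (n, g)).2.factorization p =
        n.factorization p + e * g.factorization p
  | [], _, _, _, _, _ => rfl
  | q :: l, n, g, hl, hn, hg => by
    have hq : q.Prime := hl q (by simp)
    have hl' : ∀ q' ∈ l, q'.Prime := fun q' hq' => hl q' (by simp [hq'])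
    rw [List.foldl_cons, hstep]
    split_ifs with h
    · have hdvd : q ^ e ∣ n := Nat.dvd_of_mod_eq_zero h.2
      rw [factorization_foldl_add hstep p l _ _ hl'
        (Nat.div_pos (Nat.le_of_dvd hn hdvd) (pow_pos hq.pos e)) (Nat.mul_pos hg hq.pos),
        Nat.factorization_div hdvd, Nat.factorization_mul hg.ne' hq.ne_zero, Finsupp.coe_tsub,
        Pi.sub_apply, Finsupp.coe_add, Pi.add_apply, Nat.factorization_pow, Finsupp.smul_apply,
        hq.factorization, Finsupp.single_apply, smul_eq_mul]
      have hle : e * (if q = p then 1 else 0) ≤ n.factorization p := by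
        by_cases hqp : q = p
        · subst hqp; rw [if_pos rfl, mul_one]
          exact (hq.pow_dvd_iff_le_factorization hn.ne').1 hdvd
        · rw [if_neg hqp, mul_zero]; exact Nat.zero_le _
      by_cases hqp : q = p
      · rw [if_pos hqp, mul_one] at hle; rw [if_pos hqp, mul_one, mul_add, mul_one]; omega
      · rw [if_neg hqp, mul_zero, Nat.sub_zero, add_zero]
    · exact factorization_foldl_add hstep p l n g hl' hn hg

/-! ### The program -/

/-- **The dividing fold is polynomial time on codes** (`CodeFP.foldl` with the initial value `(s, 1)` read
off the context `s`; the accumulator stays short because both components are `≤ max s 1`, `foldl_le`).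
[cite: AroraBarak2009, §1.3 (polynomial time is closed under polynomially bounded loops)] -/
theorem codeFP_foldl (he : 0 < e)
    (hstep : ∀ q n g, step q (n, g) = if 0 < n ∧ n % q ^ e = 0 then (n / q ^ e, g * q) else (n, g)) :
    CodeFP (pairE natE (rawE natE)) (pairE natE natE)
      (fun p => p.2.foldl (fun st q => step q st) (p.1, 1)) := by
  -- the step on codes; argument `(s, (q, (n, g)))`
  have hq : CodeFP (pairE natE (pairE natE (pairE natE natE))) natE (fun t => t.2.1) :=
    (fst _ _).comp (snd _ _)
  have hn : CodeFP (pairE natE (pairE natE (pairE natE natE))) natE (fun t => t.2.2.1) :=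
    (fst _ _).comp ((snd _ _).comp (snd _ _))
  have hg : CodeFP (pairE natE (pairE natE (pairE natE natE))) natE (fun t => t.2.2.2) :=
    (snd _ _).comp ((snd _ _).comp (snd _ _))
  have hqe : CodeFP (pairE natE (pairE natE (pairE natE natE))) natE (fun t => t.2.1 ^ e) :=
    natPow.comp (hq.pair (const _ e))
  have hcond : CodeFP (pairE natE (pairE natE (pairE natE natE))) bitE
      (fun t => decide (0 < t.2.2.1) && decide (t.2.2.1 % t.2.1 ^ e = 0)) :=
    (natLt.comp ((const _ 0).pair hn)).and (natEq.comp ((natMod.comp (hn.pair hqe)).pair (const _ 0)))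
  have hthen : CodeFP (pairE natE (pairE natE (pairE natE natE))) (pairE natE natE)
      (fun t => (t.2.2.1 / t.2.1 ^ e, t.2.2.2 * t.2.1)) :=
    (natDiv.comp (hn.pair hqe)).pair (natMul.comp (hg.pair hq))
  have hstepC : CodeFP (pairE natE (pairE natE (pairE natE natE))) (pairE natE natE)
      (fun t => step t.2.1 t.2.2) := by
    refine (hcond.ite hthen (hn.pair hg)).congr fun t => ?_
    obtain ⟨s, q, n, g⟩ := t
    dsimp only
    rw [hstep]
    by_cases h1 : 0 < n <;> by_cases h2 : n % q ^ e = 0 <;> simp [h1, h2]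
  have hinit : CodeFP natE (pairE natE natE) (fun s => (s, 1)) := (CodeFP.id natE).pair (const _ 1)
  refine foldl (σ := ℕ) (α := ℕ) (β := ℕ × ℕ) (eσ := natE) (eα := natE) (eβ := pairE natE natE)
    (step := fun _ q st => step q st) (init := fun s => (s, 1)) hstepC hinit (C 2 * X) fun s l₁ l₂ => ?_
  -- the accumulator stays short (binary numerals grow with the number)
  have length_natE_mono : ∀ {a b : ℕ}, a ≤ b → (natE a).length ≤ (natE b).length := fun {a b} h => by
    rw [show natE a = encodeNat a from rfl, show natE b = encodeNat b from rfl,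
      TM2Pass.length_encodeNat_eq_size, TM2Pass.length_encodeNat_eq_size]
    exact Nat.size_le_size h
  obtain ⟨ha, hb⟩ := foldl_le he hstep l₁ s
  have hb' : (natE (l₁.foldl (fun st q => step q st) (s, 1)).2).length ≤ (natE s).length + 1 := by
    refine (length_natE_mono hb).trans ?_
    rcases Nat.eq_zero_or_pos s with rfl | hs
    · exact le_rfl
    · rw [max_eq_left hs]; exact Nat.le_succ _
  have ha' := length_natE_mono ha
  simp only [pairE, length_boolPair, eval_mul, eval_C, eval_X]
  omega

/-- **The cube-part decomposition in polynomial time from the factor list.** There is a polynomial-time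
program on codes, `(L, m) ↦ (f, a, b)` — the dividing fold with cubes over `L` from `(m, 1)` giving
`(c, f)`, then the dividing fold with squares over `L` from `(c, 1)` giving `(a, b)` — such that for
every `m ≥ 1`, on the list `L = primeFactorsList m`: `m = f³·(a·b²)` and `a·b` is squarefree (so
`(a, b) = 1`; `ℚ(∛m) = ℚ(∛(ab²))`).
[cite: Cohen1993, §6.4.5 (pure cubic fields: m = ab² up to cubes, ab squarefree)] -/
theorem exists_split :
    ∃ split : List ℕ × ℕ → ℕ × (ℕ × ℕ),
      CodeFP (pairE (rawE natE) natE) (pairE natE (pairE natE natE)) split ∧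
      ∀ m : ℕ, 0 < m →
        m = (split (m.primeFactorsList, m)).1 ^ 3 *
            ((split (m.primeFactorsList, m)).2.1 * (split (m.primeFactorsList, m)).2.2 ^ 2) ∧
          Squarefree ((split (m.primeFactorsList, m)).2.1 * (split (m.primeFactorsList, m)).2.2) := by
  -- the two steps and folds
  obtain ⟨st3, h3⟩ : ∃ st : ℕ → ℕ × ℕ → ℕ × ℕ,
      ∀ q n g, st q (n, g) = if 0 < n ∧ n % q ^ 3 = 0 then (n / q ^ 3, g * q) else (n, g) :=
    ⟨fun q x => if 0 < x.1 ∧ x.1 % q ^ 3 = 0 then (x.1 / q ^ 3, x.2 * q) else x, fun _ _ _ => rfl⟩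
  obtain ⟨st2, h2⟩ : ∃ st : ℕ → ℕ × ℕ → ℕ × ℕ,
      ∀ q n g, st q (n, g) = if 0 < n ∧ n % q ^ 2 = 0 then (n / q ^ 2, g * q) else (n, g) :=
    ⟨fun q x => if 0 < x.1 ∧ x.1 % q ^ 2 = 0 then (x.1 / q ^ 2, x.2 * q) else x, fun _ _ _ => rfl⟩
  set F3 : List ℕ × ℕ → ℕ × ℕ := fun p => p.1.foldl (fun x q => st3 q x) (p.2, 1) with hF3
  set F2 : List ℕ × ℕ → ℕ × ℕ := fun p => p.1.foldl (fun x q => st2 q x) ((F3 p).1, 1) with hF2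
  refine ⟨fun p => ((F3 p).2, F2 p), ?_, fun m hm => ?_⟩
  · have c3 := codeFP_foldl (by norm_num) h3
    have c2 := codeFP_foldl (by norm_num) h2
    have hin3 : CodeFP (pairE (rawE natE) natE) (pairE natE (rawE natE)) (fun p => (p.2, p.1)) :=
      (snd _ _).pair (fst _ _)
    have hF3c : CodeFP (pairE (rawE natE) natE) (pairE natE natE) F3 := (c3.comp hin3).congr fun _ => rfl
    have hin2 : CodeFP (pairE (rawE natE) natE) (pairE natE (rawE natE)) (fun p => ((F3 p).1, p.1)) :=
      hF3c.fst'.pair (fst _ _)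
    have hF2c : CodeFP (pairE (rawE natE) natE) (pairE natE natE) F2 := (c2.comp hin2).congr fun _ => rfl
    exact hF3c.snd'.pair hF2c
  · -- correctness on `L = primeFactorsList m`
    set L := m.primeFactorsList with hL
    have hprime : ∀ q ∈ L, q.Prime := fun q hq => Nat.prime_of_mem_primeFactorsList hq
    have hcount : ∀ p, L.count p = m.factorization p := fun p => Nat.primeFactorsList_count_eq
    change m = (F3 (L, m)).2 ^ 3 * ((F2 (L, m)).1 * (F2 (L, m)).2 ^ 2) ∧
      Squarefree ((F2 (L, m)).1 * (F2 (L, m)).2)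
    have hF3v : F3 (L, m) = L.foldl (fun x q => st3 q x) (m, 1) := rfl
    have hF2v : F2 (L, m) = L.foldl (fun x q => st2 q x) ((F3 (L, m)).1, 1) := rfl
    -- first fold: `c · f³ = m`, `c ≥ 1`, `v_p(c) ≤ 2`
    have hinv3 := fst_mul_pow_foldl h3 L m 1
    rw [one_pow, mul_one, ← hF3v] at hinv3
    obtain ⟨hc, -⟩ := foldl_pos (by norm_num) h3 L m 1 hm
    rw [← hF3v] at hc
    have hv3 : ∀ p, p.Prime → (F3 (L, m)).1.factorization p ≤ 2 := fun p hp => by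
      have h := factorization_foldl_le (by norm_num) h3 hp L m 1 hprime hm (by rw [hcount]; omega)
      rwa [← hF3v] at h
    have hcm : ∀ p, (F3 (L, m)).1.factorization p ≤ m.factorization p := fun p =>
      (Nat.factorization_le_iff_dvd hc.ne' hm.ne').2 ⟨_, hinv3.symm⟩ p
    -- second fold: `a · b² = c`, `a, b ≥ 1`, `v_p(a) ≤ 1`, `v_p(a) + 2 v_p(b) = v_p(c)`
    have hinv2 := fst_mul_pow_foldl h2 L (F3 (L, m)).1 1
    rw [one_pow, mul_one, ← hF2v] at hinv2
    obtain ⟨ha, hb⟩ := foldl_pos (by norm_num) h2 L (F3 (L, m)).1 1 hc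
    rw [← hF2v] at ha hb
    have hv2 : ∀ p, p.Prime → (F2 (L, m)).1.factorization p ≤ 1 := fun p hp => by
      have hbound : (F3 (L, m)).1.factorization p ≤ 2 * L.count p + (2 - 1) := by
        rw [hcount]
        have h1 := hv3 p hp
        have h2 := hcm p
        rcases Nat.eq_zero_or_pos (m.factorization p) with h0 | h0 <;> omega
      have h := factorization_foldl_le (by norm_num) h2 hp L (F3 (L, m)).1 1 hprime hc hbound
      rwa [← hF2v] at h
    have hadd : ∀ p, (F2 (L, m)).1.factorization p + 2 * (F2 (L, m)).2.factorization p =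
        (F3 (L, m)).1.factorization p := fun p => by
      have h := factorization_foldl_add h2 p L (F3 (L, m)).1 1 hprime hc Nat.one_pos
      rwa [← hF2v, Nat.factorization_one, Finsupp.coe_zero, Pi.zero_apply, mul_zero, add_zero] at h
    refine ⟨?_, ?_⟩
    · rw [hinv2, mul_comm, hinv3]
    · have hb0 : (F2 (L, m)).2 ≠ 0 := by omega
      refine (Nat.squarefree_iff_factorization_le_one (Nat.mul_ne_zero ha.ne' hb0)).2 fun p => ?_
      rw [Nat.factorization_mul ha.ne' hb0, Finsupp.coe_add, Pi.add_apply]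
      by_cases hp : p.Prime
      · have e1 := hv2 p hp
        have e2 := hadd p
        have e3 := hv3 p hp
        omega
      · rw [Nat.factorization_eq_zero_of_not_prime _ hp, Nat.factorization_eq_zero_of_not_prime _ hp]
        exact Nat.zero_le _

end CubeSplit

end Literature.Computability.Complexity.CodeFP
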